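import Summits.NavierStokesRegularity.FluidComputer.LerayClock
import HarnessLib

/-!
# Fluid computer — the TIME FACE of the level dictionary, IV: LERAY'S DEADLINE and LERAY'S WINDOW (L23)

HONEST FRAMING (cell `pub-fluidc`, verbatim): *low prior, high value-of-information experiment on Tao's
machine paradigm; NOT a claim that NS blows up.* Theorem side of the cell; nothing here is evidence of blow-up.
Companion of `LerayClock` (L19: the COUNTDOWN `c ν³ ≤ (∫|∇u(t)|²)² (T − t)` — a blow-up cannot come SOONER than
the enstrophy allows). Here the window is closed FROM ABOVE: for every maximal smooth solution `(u, p)` of the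
unforced Navier–Stokes system on `ℝ³ × [0, T)` (`ν > 0`) which is Leray–Hopf from `u 0`,

* `windowed_dissipation_le_energy` — `ν ∫_{t}^{T₂} ∫|∇u|² ≤ ½ ‖u(t)‖₂²` for `0 ≤ t < T₂ < T` (the energy inequality
  FROM EVERY TIME `t`, with the classical gradient: the translate `u(· + t)` is Leray–Hopf from `u(t)` on every
  shorter window, `LerayClock.isLerayHopfOn_translate`, and `IsLerayHopfOn.lintegral_frobeniusNormSq_fderiv_of_classical`);
* `deadline` (**L23, LERAY'S DEADLINE**) — with THE SAME absolute `c` as the countdown: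
  `4 c ν⁵ (T − t) ≤ ‖u(t)‖₂⁴` at EVERY `t ∈ [0, T)` — a blow-up must come within `‖u(t)‖₂⁴/(4 c ν⁵)` of every
  instant, or never (Leray 1934, §34: the definitive epoch of regularity `Θ ≤ C W(0)²/ν⁵`); in particular
  `lifespan_le`: `T ≤ ‖u(0)‖₂⁴/(4 c ν⁵)`. Proof: integrate the countdown's rate `∫|∇u(τ)|² ≥ √(c ν³/(T − τ)) ≥
  √(c ν³/(T − t))` over `τ ∈ (t, T₂)` against the windowed energy inequality and let `T₂ → T`;
* `leray_window` (**THE TWO-SIDED WINDOW**) — `c ν³/(∫|∇u(t)|²)² ≤ T − t ≤ ‖u(t)‖₂⁴/(4 c ν⁵)` for every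
  `t ∈ (0, T)`: at every instant the time-to-blow-up is pinned between the enstrophy countdown and the energy
  deadline;
* `energy_enstrophy_product_ge` (**L23′, THE SCALE-INVARIANT NECESSITY**) — `2 c ν⁴ ≤ ‖u(t)‖₂² · ∫|∇u(t)|²` at
  EVERY `t ∈ (0, T)`: along a realised blow-up the scale-invariant product `‖u‖₂²‖∇u‖₂²/ν⁴` NEVER drops below an
  absolute constant (the window is non-empty) — the machine can never be globally small;
* `deadline_blockL2` (level currency) — `c ν⁵ (T − t) ≤ (∑_l ‖Δ̇_l u(t)‖₂²)²`: the summed block energies cannot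
  have fallen below `ν^{5/2} √(c (T − t))` (lower square-function bound).

HONEST SIZE NOTE: `c` inexplicit; for the cell's fields (`‖u(0)‖₂² = 0.25`, `ν⁵ ≈ 3.9·10⁻¹³` at `ρ = 3`) the
deadline is astronomically far — words, not numbers: 'the cascade must finish inside Leray's window'. Necessity
only. 0 sorry; no new definitions, no named facts.

## References

* J. Leray, Acta Math. 63 (1934) 193–248, §20, §34. [Leray1934]
* J. C. Robinson, J. L. Rodrigo, W. Sadowski, *The Three-Dimensional Navier–Stokes Equations*, CUP 2016,
  Lemma 6.11, Thm. 8.14. [RobinsonRodrigoSadowski2016]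
* P. Constantin, C. Foias, *Navier–Stokes Equations*, Univ. Chicago Press 1988, Ch. 9–10 (the energy
  inequality). [ConstantinFoias1988]
-/

noncomputable section

open MeasureTheory Set Function Filter Topology Metric
open scoped ENNReal NNReal RealInnerProductSpace
open Literature.Analysis.FluidPDE Literature.Analysis.FunctionSpaces
open Literature.Analysis.FluidPDE.LPBounds (gradSq)
open Summit.NavierStokesRegularity.FluidComputer.LerayClock

namespace Summit.NavierStokesRegularity.FluidComputer.LerayDeadline

/-! ## The energy inequality from every time, with the classical gradient -/

/-- **The windowed energy inequality.** Along every maximal smooth Leray–Hopf solution of the unforced system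
(`ν > 0`), for every `t ∈ [0, T)` and every `T₂ ∈ (t, T)`: the dissipation `D = ∫_{(0, T₂−t)} ∫|∇u(τ + t)|²` is
finite and `ν · D ≤ ½ ‖u(t)‖₂²` — the energy inequality FROM time `t` (the translate is Leray–Hopf from `u(t)` on
`[0, T₂ − t)`, `LerayClock.isLerayHopfOn_translate`; classical gradient = weak gradient a.e.,
`IsLerayHopfOn.lintegral_frobeniusNormSq_fderiv_of_classical`). [cite: RobinsonRodrigoSadowski2016, Def. 4.9 and Cor. 4.8] -/
theorem windowed_dissipation_le_energy {ν T : ℝ} (hν : 0 < ν) (hT : 0 < T)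
    {u : ℝ → EuclideanSpace ℝ (Fin 3) → EuclideanSpace ℝ (Fin 3)} {p : ℝ → EuclideanSpace ℝ (Fin 3) → ℝ}
    (hmax : IsMaximalSmoothSolution ν 0 u p T) (hLH : IsLerayHopfOn T ν 0 (u 0) u)
    {t : ℝ} (ht : t ∈ Ico 0 T) {T₂ : ℝ} (hT₂ : T₂ ∈ Ioo t T) :
    (∫⁻ τ in Ioo 0 (T₂ - t), ∫⁻ x, ENNReal.ofReal (frobeniusNormSq (fderiv ℝ (u (τ + t)) x))) ≠ ∞ ∧
    ν * (∫⁻ τ in Ioo 0 (T₂ - t), ∫⁻ x, ENNReal.ofReal (frobeniusNormSq (fderiv ℝ (u (τ + t)) x))).toReal ≤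
      (eLpNorm (u t) 2 volume).toReal ^ 2 / 2 := by
  -- the translate is classical on `[0, T₂ - t)`
  have hcl : IsClassicalNSSolutionOn (Ico 0 (T₂ - t)) ν 0 (fun s => u (s + t)) (fun s => p (s + t)) := by
    have h := hmax.1.comp_add_right t
    have h0 : (fun s => (0 : ℝ → EuclideanSpace ℝ (Fin 3) → EuclideanSpace ℝ (Fin 3)) (s + t)) = 0 := rfl
    rw [h0] at h
    refine h.mono (fun s hs => ?_) (uniqueDiffOn_Ico 0 (T₂ - t))
    simp only [mem_preimage, mem_Ico] at hs ⊢
    exact ⟨by linarith [hs.1, ht.1], by linarith [hs.2, hT₂.2]⟩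
  -- and Leray–Hopf from `u t` there
  have hLHt : IsLerayHopfOn (T₂ - t) ν 0 ((fun s => u (s + t)) 0) (fun s => u (s + t)) := by
    rcases ht.1.eq_or_lt with h0 | h0
    · subst h0
      simp only [add_zero, sub_zero]
      exact hLH.of_le hT₂.2.le
    · simpa only [zero_add] using isLerayHopfOn_translate hν hT hmax.1 hLH ⟨h0, ht.2⟩ hT₂
  obtain ⟨h1, h2⟩ := IsLerayHopfOn.lintegral_frobeniusNormSq_fderiv_of_classical hcl hLHt (sub_pos.2 hT₂.1)
  refine ⟨h1, h2.trans_eq ?_⟩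
  simp only [zero_add]
  rw [kineticEnergy_eq_half_toReal_eLpNorm_sq (hLH.memLp t ⟨ht.1, ht.2.le⟩)]
  ring

/-! ## L23: Leray's deadline, with the countdown's constant -/

/-- **COUNTDOWN AND DEADLINE WITH ONE CONSTANT.** There is an absolute `c > 0` such that for every `ν > 0`,
`T > 0` and every maximal smooth solution `(u, p)` of the unforced Navier–Stokes system on `ℝ³ × [0, T)` which is
Leray–Hopf from `u 0`: (i) COUNTDOWN — `c ν³ ≤ (∫|∇u(t)|²)² (T − t)` for every `t ∈ (0, T)`
(`LerayClock.enstrophy_clock_toReal`); (ii) DEADLINE — `4 c ν⁵ (T − t) ≤ ‖u(t)‖₂⁴` for every `t ∈ [0, T)`: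
integrating the rate `∫|∇u(τ)|² ≥ √(c ν³/(T − t))` (`τ ∈ (t, T₂)`) against the windowed energy inequality
`ν ∫_t^{T₂} ∫|∇u|² ≤ ½‖u(t)‖₂²` gives `ν √(c ν³/(T − t)) (T₂ − t) ≤ ½‖u(t)‖₂²` for every `T₂ < T`; let `T₂ → T`
and square. [cite: Leray1934, §34] [cite: RobinsonRodrigoSadowski2016, Lemma 6.11] -/
theorem countdown_and_deadline :
    ∃ c : ℝ, 0 < c ∧ ∀ (ν T : ℝ), 0 < ν → 0 < T →
      ∀ (u : ℝ → EuclideanSpace ℝ (Fin 3) → EuclideanSpace ℝ (Fin 3)) (p : ℝ → EuclideanSpace ℝ (Fin 3) → ℝ),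
      IsMaximalSmoothSolution ν 0 u p T → IsLerayHopfOn T ν 0 (u 0) u →
      (∀ t ∈ Ioo 0 T, c * ν ^ 3 ≤
        (∫⁻ x, ENNReal.ofReal (frobeniusNormSq (fderiv ℝ (u t) x))).toReal ^ 2 * (T - t)) ∧
      ∀ t ∈ Ico 0 T, 4 * c * ν ^ 5 * (T - t) ≤ (eLpNorm (u t) 2 volume).toReal ^ 4 := by
  obtain ⟨c, hc, H⟩ := enstrophy_clock_toReal
  refine ⟨c, hc, fun ν T hν hT u p hmax hLH => ⟨H ν T hν hT u p hmax hLH, fun t ht => ?_⟩⟩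
  set E : ℝ := (eLpNorm (u t) 2 volume).toReal with hE
  have hTt : 0 < T - t := sub_pos.2 ht.2
  set r₀ : ℝ := Real.sqrt (c * ν ^ 3 / (T - t)) with hr₀
  have hr₀0 : 0 ≤ r₀ := Real.sqrt_nonneg _
  -- Step 1: for every `T₂ ∈ (t, T)`, `ν r₀ (T₂ - t) ≤ E²/2`
  have hstep : ∀ T₂ ∈ Ioo t T, ν * r₀ * (T₂ - t) ≤ E ^ 2 / 2 := by
    intro T₂ hT₂
    obtain ⟨hDtop, hD⟩ := windowed_dissipation_le_energy hν hT hmax hLH ht hT₂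
    -- the rate at every time of the window
    have hptw : ∀ τ ∈ Ioo 0 (T₂ - t),
        ENNReal.ofReal r₀ ≤ ∫⁻ x, ENNReal.ofReal (frobeniusNormSq (fderiv ℝ (u (τ + t)) x)) := by
      intro τ hτ
      have hτt : τ + t ∈ Ioo 0 T := ⟨by linarith [hτ.1, ht.1], by linarith [hτ.2, hT₂.2]⟩
      obtain ⟨hZ, hZtop⟩ := lintegral_frobeniusNormSq_eq_gradSq hν hT hmax hLH hτt
      have hc' := H ν T hν hT u p hmax hLH (τ + t) hτt
      rw [hZ] at hc' ⊢
      rw [← ENNReal.ofReal_toReal hZtop]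
      refine ENNReal.ofReal_le_ofReal ?_
      have hZ0 : 0 ≤ (gradSq (u (τ + t))).toReal := ENNReal.toReal_nonneg
      have h1 : c * ν ^ 3 / (T - t) ≤ (gradSq (u (τ + t))).toReal ^ 2 := by
        rw [div_le_iff₀ hTt]
        calc c * ν ^ 3 ≤ (gradSq (u (τ + t))).toReal ^ 2 * (T - (τ + t)) := hc'
          _ ≤ (gradSq (u (τ + t))).toReal ^ 2 * (T - t) :=
              mul_le_mul_of_nonneg_left (by linarith [hτ.1]) (sq_nonneg _)
      calc r₀ = Real.sqrt (c * ν ^ 3 / (T - t)) := rfl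
        _ ≤ Real.sqrt ((gradSq (u (τ + t))).toReal ^ 2) := Real.sqrt_le_sqrt h1
        _ = (gradSq (u (τ + t))).toReal := Real.sqrt_sq hZ0
    -- integrate over the window
    have hint : ENNReal.ofReal r₀ * ENNReal.ofReal (T₂ - t) ≤
        ∫⁻ τ in Ioo 0 (T₂ - t), ∫⁻ x, ENNReal.ofReal (frobeniusNormSq (fderiv ℝ (u (τ + t)) x)) := by
      calc ENNReal.ofReal r₀ * ENNReal.ofReal (T₂ - t) = ∫⁻ _ in Ioo 0 (T₂ - t), ENNReal.ofReal r₀ := by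
            rw [setLIntegral_const, Real.volume_Ioo, sub_zero]
        _ ≤ _ := setLIntegral_mono' measurableSet_Ioo fun τ hτ => hptw τ hτ
    have hreal := ENNReal.toReal_mono hDtop hint
    rw [ENNReal.toReal_mul, ENNReal.toReal_ofReal hr₀0, ENNReal.toReal_ofReal (by linarith [hT₂.1])] at hreal
    calc ν * r₀ * (T₂ - t) = ν * (r₀ * (T₂ - t)) := by ring
      _ ≤ ν * (∫⁻ τ in Ioo 0 (T₂ - t),
            ∫⁻ x, ENNReal.ofReal (frobeniusNormSq (fderiv ℝ (u (τ + t)) x))).toReal :=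
          mul_le_mul_of_nonneg_left hreal hν.le
      _ ≤ E ^ 2 / 2 := hD
  -- Step 2: `T₂ → T`
  have hlim : ν * r₀ * (T - t) ≤ E ^ 2 / 2 := by
    have htend : Tendsto (fun T₂ : ℝ => ν * r₀ * (T₂ - t)) (𝓝[<] T) (𝓝 (ν * r₀ * (T - t))) :=
      ((continuous_const.mul (continuous_id.sub continuous_const)).tendsto T).mono_left nhdsWithin_le_nhds
    refine le_of_tendsto htend ?_
    filter_upwards [Ioo_mem_nhdsLT ht.2] with T₂ hT₂ using hstep T₂ hT₂
  -- Step 3: square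
  have hsq : (ν * r₀ * (T - t)) ^ 2 = c * ν ^ 5 * (T - t) := by
    rw [mul_pow, mul_pow, hr₀, Real.sq_sqrt (by positivity)]
    field_simp
  have h0 : 0 ≤ ν * r₀ * (T - t) := by positivity
  have h4 : (ν * r₀ * (T - t)) ^ 2 ≤ (E ^ 2 / 2) ^ 2 := pow_le_pow_left₀ h0 hlim 2
  rw [hsq] at h4
  nlinarith [h4]

/-- **L23 — LERAY'S DEADLINE.** There is an absolute `c > 0` (the countdown's constant) such that along every
maximal smooth Leray–Hopf solution of the unforced system on `ℝ³ × [0, T)` (`ν > 0`), at EVERY instant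
`t ∈ [0, T)`: `4 c ν⁵ (T − t) ≤ ‖u(t)‖₂⁴` — the blow-up must come within `‖u(t)‖₂⁴/(4 c ν⁵)` of every instant; the
window in which the machine must finish SHRINKS with the energy. [cite: Leray1934, §34] -/
theorem deadline :
    ∃ c : ℝ, 0 < c ∧ ∀ (ν T : ℝ), 0 < ν → 0 < T →
      ∀ (u : ℝ → EuclideanSpace ℝ (Fin 3) → EuclideanSpace ℝ (Fin 3)) (p : ℝ → EuclideanSpace ℝ (Fin 3) → ℝ),
      IsMaximalSmoothSolution ν 0 u p T → IsLerayHopfOn T ν 0 (u 0) u →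
      ∀ t ∈ Ico 0 T, 4 * c * ν ^ 5 * (T - t) ≤ (eLpNorm (u t) 2 volume).toReal ^ 4 := by
  obtain ⟨c, hc, H⟩ := countdown_and_deadline
  exact ⟨c, hc, fun ν T hν hT u p hmax hLH => (H ν T hν hT u p hmax hLH).2⟩

/-- **The lifespan of a blow-up is bounded by the initial energy**: `4 c ν⁵ T ≤ ‖u(0)‖₂⁴`, i.e.
`T ≤ ‖u(0)‖₂⁴/(4 c ν⁵)` (Leray's definitive epoch of regularity). [cite: Leray1934, §34] -/
theorem lifespan_le :
    ∃ c : ℝ, 0 < c ∧ ∀ (ν T : ℝ), 0 < ν → 0 < T →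
      ∀ (u : ℝ → EuclideanSpace ℝ (Fin 3) → EuclideanSpace ℝ (Fin 3)) (p : ℝ → EuclideanSpace ℝ (Fin 3) → ℝ),
      IsMaximalSmoothSolution ν 0 u p T → IsLerayHopfOn T ν 0 (u 0) u →
      4 * c * ν ^ 5 * T ≤ (eLpNorm (u 0) 2 volume).toReal ^ 4 := by
  obtain ⟨c, hc, H⟩ := deadline
  refine ⟨c, hc, fun ν T hν hT u p hmax hLH => ?_⟩
  simpa only [sub_zero] using H ν T hν hT u p hmax hLH 0 ⟨le_rfl, hT⟩

/-- **LERAY'S WINDOW (two-sided).** With the constant `c` of `countdown_and_deadline`: at every `t ∈ (0, T)` of a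
maximal smooth Leray–Hopf solution the enstrophy `Z(t) = ∫|∇u(t)|²` is finite and positive and
`c ν³ / Z(t)² ≤ T − t ≤ ‖u(t)‖₂⁴ / (4 c ν⁵)` — the time-to-blow-up is pinned between the enstrophy countdown and
the energy deadline. [cite: Leray1934, §20 and §34] [cite: RobinsonRodrigoSadowski2016, Lemma 6.11] -/
theorem leray_window :
    ∃ c : ℝ, 0 < c ∧ ∀ (ν T : ℝ), 0 < ν → 0 < T →
      ∀ (u : ℝ → EuclideanSpace ℝ (Fin 3) → EuclideanSpace ℝ (Fin 3)) (p : ℝ → EuclideanSpace ℝ (Fin 3) → ℝ),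
      IsMaximalSmoothSolution ν 0 u p T → IsLerayHopfOn T ν 0 (u 0) u →
      ∀ t ∈ Ioo 0 T,
        0 < (∫⁻ x, ENNReal.ofReal (frobeniusNormSq (fderiv ℝ (u t) x))).toReal ∧
        c * ν ^ 3 / (∫⁻ x, ENNReal.ofReal (frobeniusNormSq (fderiv ℝ (u t) x))).toReal ^ 2 ≤ T - t ∧
        T - t ≤ (eLpNorm (u t) 2 volume).toReal ^ 4 / (4 * c * ν ^ 5) := by
  obtain ⟨c, hc, H⟩ := countdown_and_deadline
  refine ⟨c, hc, fun ν T hν hT u p hmax hLH t ht => ?_⟩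
  obtain ⟨H1, H2⟩ := H ν T hν hT u p hmax hLH
  have h1 := H1 t ht
  have h2 := H2 t ⟨ht.1.le, ht.2⟩
  have hTt : 0 < T - t := sub_pos.2 ht.2
  have hcν : 0 < c * ν ^ 3 := by positivity
  set Z : ℝ := (∫⁻ x, ENNReal.ofReal (frobeniusNormSq (fderiv ℝ (u t) x))).toReal with hZ
  have hZ0 : 0 ≤ Z := ENNReal.toReal_nonneg
  have hZne : Z ≠ 0 := by
    intro h0
    rw [h0, zero_pow two_ne_zero, zero_mul] at h1
    linarith
  have hZpos : 0 < Z := lt_of_le_of_ne hZ0 (Ne.symm hZne)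
  refine ⟨hZpos, ?_, ?_⟩
  · rw [div_le_iff₀ (by positivity)]
    linarith [h1]
  · rw [le_div_iff₀ (by positivity)]
    linarith [h2]

/-- **L23′ — THE SCALE-INVARIANT NECESSITY: the window is never empty.** With the constant `c` of
`countdown_and_deadline`: at EVERY `t ∈ (0, T)` of a maximal smooth Leray–Hopf solution of the unforced system,
`2 c ν⁴ ≤ ‖u(t)‖₂² · ∫|∇u(t)|²` — along a realised blow-up the scale-invariant product `‖u‖₂² ‖∇u‖₂² / ν⁴` never
drops below an absolute constant (countdown × deadline: `c ν³ · 4 c ν⁵ (T − t) ≤ Z² (T − t) · ‖u‖₂⁴`). The machine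
can never be globally small: this is the smallness that forces global regularity, read as a necessity.
[cite: Leray1934, §20 and §34] [cite: RobinsonRodrigoSadowski2016, Lemma 6.11 with Thm. 6.8] -/
theorem energy_enstrophy_product_ge :
    ∃ c : ℝ, 0 < c ∧ ∀ (ν T : ℝ), 0 < ν → 0 < T →
      ∀ (u : ℝ → EuclideanSpace ℝ (Fin 3) → EuclideanSpace ℝ (Fin 3)) (p : ℝ → EuclideanSpace ℝ (Fin 3) → ℝ),
      IsMaximalSmoothSolution ν 0 u p T → IsLerayHopfOn T ν 0 (u 0) u →
      ∀ t ∈ Ioo 0 T, 2 * c * ν ^ 4 ≤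
        (eLpNorm (u t) 2 volume).toReal ^ 2 * (∫⁻ x, ENNReal.ofReal (frobeniusNormSq (fderiv ℝ (u t) x))).toReal := by
  obtain ⟨c, hc, H⟩ := countdown_and_deadline
  refine ⟨c, hc, fun ν T hν hT u p hmax hLH t ht => ?_⟩
  obtain ⟨H1, H2⟩ := H ν T hν hT u p hmax hLH
  have h1 := H1 t ht
  have h2 := H2 t ⟨ht.1.le, ht.2⟩
  have hTt : 0 < T - t := sub_pos.2 ht.2
  set Z : ℝ := (∫⁻ x, ENNReal.ofReal (frobeniusNormSq (fderiv ℝ (u t) x))).toReal with hZ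
  set E : ℝ := (eLpNorm (u t) 2 volume).toReal with hE
  have hZ0 : 0 ≤ Z := ENNReal.toReal_nonneg
  have hE0 : 0 ≤ E := ENNReal.toReal_nonneg
  -- `(2 c ν⁴)² (T - t) = c ν³ · 4 c ν⁵ (T - t) ≤ Z² (T - t) · E⁴ = (E² Z)² (T - t)`
  have hprod : (2 * c * ν ^ 4) ^ 2 * (T - t) ≤ (E ^ 2 * Z) ^ 2 * (T - t) := by
    have h3 : c * ν ^ 3 * (4 * c * ν ^ 5 * (T - t)) ≤ Z ^ 2 * (T - t) * E ^ 4 :=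
      mul_le_mul h1 h2 (by positivity) (by positivity)
    calc (2 * c * ν ^ 4) ^ 2 * (T - t) = c * ν ^ 3 * (4 * c * ν ^ 5 * (T - t)) := by ring
      _ ≤ Z ^ 2 * (T - t) * E ^ 4 := h3
      _ = (E ^ 2 * Z) ^ 2 * (T - t) := by ring
  have h4 : (2 * c * ν ^ 4) ^ 2 ≤ (E ^ 2 * Z) ^ 2 := le_of_mul_le_mul_right hprod hTt
  exact (pow_le_pow_iff_left₀ (by positivity) (by positivity) two_ne_zero).1 h4

/-- **The deadline in level currency.** With the constant `c` of `countdown_and_deadline`: at every `t ∈ [0, T)`,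
`c ν⁵ (T − t) ≤ (∑_{l∈ℤ} ‖Δ̇_l u(t)‖₂²)²` — the summed block energies cannot have fallen below `ν^{5/2} √(c (T − t))`
(`‖u(t)‖₂² ≤ 2 ∑_l ‖Δ̇_l u(t)‖₂²`, the lower square-function bound). [cite: Leray1934, §34]
[cite: BahouriCheminDanchin2011, Prop. 2.12] -/
theorem deadline_blockL2 :
    ∃ c : ℝ, 0 < c ∧ ∀ (ν T : ℝ), 0 < ν → 0 < T →
      ∀ (u : ℝ → EuclideanSpace ℝ (Fin 3) → EuclideanSpace ℝ (Fin 3)) (p : ℝ → EuclideanSpace ℝ (Fin 3) → ℝ),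
      IsMaximalSmoothSolution ν 0 u p T → IsLerayHopfOn T ν 0 (u 0) u →
      ∀ t ∈ Ico 0 T, c * ν ^ 5 * (T - t) ≤ (∑' l : ℤ, blockL2 (u t) l ^ 2).toReal ^ 2 := by
  obtain ⟨c, hc, H⟩ := deadline
  refine ⟨c, hc, fun ν T hν hT u p hmax hLH t ht => ?_⟩
  set K := lpBounds (Fin 3) with hK
  have hut : MemLp (u t) 2 volume := hLH.memLp t ⟨ht.1, ht.2.le⟩
  have hEtop : eLpNorm (u t) 2 volume ≠ ⊤ := hut.eLpNorm_ne_top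
  have h := H ν T hν hT u p hmax hLH t ht
  -- `‖u(t)‖₂² ≤ 2 ∑_l a_l²`, in real numbers (the sum is finite: `≤ 8 ‖u(t)‖₂²`)
  have hStop : (∑' l : ℤ, blockL2 (u t) l ^ 2) ≠ ⊤ :=
    ne_top_of_le_ne_top (ENNReal.mul_ne_top (by norm_num) (ENNReal.pow_ne_top hEtop)) (K.sq_le _ hut)
  have hle : (eLpNorm (u t) 2 volume).toReal ^ 2 ≤ 2 * (∑' l : ℤ, blockL2 (u t) l ^ 2).toReal := by
    have h1 := ENNReal.toReal_mono (ENNReal.mul_ne_top (by norm_num) hStop) (K.le_sq _ hut)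
    rw [ENNReal.toReal_pow, ENNReal.toReal_mul, ENNReal.toReal_ofNat] at h1
    exact h1
  have hS0 : 0 ≤ (∑' l : ℤ, blockL2 (u t) l ^ 2).toReal := ENNReal.toReal_nonneg
  nlinarith [h, hle, pow_le_pow_left₀ (sq_nonneg _) hle 2, hS0]

end Summit.NavierStokesRegularity.FluidComputer.LerayDeadline

end
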